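import Summits.Ventures.PercRepro.S1TrianglePlusFreeA

/-!
# PercRepro — THE FREE CONE, part B: the plane of a triangle avoiding `x` (p1, gen 20; (C1) only)

Setting as in part A: (C1), `x` a non-loop, `s` the triangles through `x`, `U = {x} ∪ ⋃ s` the cone, free
(`r(U) = #s + 1`), and a point `f ∉ U`. A triangle `T = {f, a, b}` avoiding `x` with `a, b ∈ U` has `a, b` on two
DISTINCT triangles `C ≠ C'` through `x` (else `{x, a, b, f}` is a 4-point line) and `f ∈ cl(C ∪ C')`, a
rank-`3` flat (`eRk_union_eq_three_of_free`). Two such triangles `T, T'` use the SAME pair `{C, C'}`: if `T'`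
used a third triangle `C''`, the two planes `cl(C ∪ C')` and `cl(C'' ∪ D)` (both containing `x` and `f`) would
meet in a set of rank `≤ 2` containing a triangle through `x` together with `f` (a 4-point line), or — when
all four are distinct — in a set of rank `≤ 1` containing `x` and `f`, so that `C ∪ {f}` is a 4-point line.

* `inter_eq_of_triangles_through` — two distinct triangles through `f` meet only in `f` (TriangleStar);
* `pair_of_triangle_avoiding` — `C ≠ C'` and `f ∈ cl(C ∪ C')`;
* `eRk_union_eq_three_of_free` — `r(C ∪ C') = 3` for two distinct triangles through `x` of a free cone;
* **`same_pair_of_triangles_avoiding`** — the same-pair claim.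
Axioms: standard.
-/

open scoped Matroid

namespace PercRepro

namespace S1

open Set

variable {α : Type}

/-- Two triangles avoiding `x` with the same one-point part `{f}` outside the cone are disjoint inside the cone
(they are two triangles through `f`, which meet only in `f` under (C1)). -/
theorem inter_eq_of_triangles_through (M : Matroid α) [M.Finite]
    (hC1 : ∀ L ⊆ M.E, M.eRk L = 2 → L.ncard ≤ 3) {f : α} {T T' : Set α}
    (hT : T ∈ ThmN.triangles M) (hT' : T' ∈ ThmN.triangles M) (hfT : f ∈ T) (hfT' : f ∈ T')
    (hne : T ≠ T') : T ∩ T' = {f} :=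
  ThmN.inter_eq_singleton_of_mem_trianglesThrough M hC1 ⟨hT.1, hT.2, hfT⟩ ⟨hT'.1, hT'.2, hfT'⟩ hne

/-- A triangle `{f, a, b}` avoiding `x`, with `f` outside the cone and `a ∈ C`, `b ∈ C'` on triangles through
`x`: `C ≠ C'` and `f ∈ cl (C ∪ C')`. -/
theorem pair_of_triangle_avoiding (M : Matroid α) [M.Finite]
    (hC1 : ∀ L ⊆ M.E, M.eRk L = 2 → L.ncard ≤ 3) {x : α} (hx : M.IsNonloop x)
    (s : Finset (Set α)) (hs : ∀ C ∈ s, C ∈ ThmN.trianglesThrough M x)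
    {f : α} (hfU : f ∉ {x} ∪ ⋃ C ∈ s, C) (hfE : f ∈ M.E)
    {T : Set α} (hT : T ∈ ThmN.triangles M) (hxT : x ∉ T) (hfT : f ∈ T)
    {a b : α} (ha : a ∈ T ∩ ({x} ∪ ⋃ C ∈ s, C)) (hb : b ∈ T ∩ ({x} ∪ ⋃ C ∈ s, C)) (hab : a ≠ b)
    {C C' : Set α} (hC : C ∈ s) (haC : a ∈ C) (hC' : C' ∈ s) (hbC' : b ∈ C') :
    C ≠ C' ∧ f ∈ M.closure (C ∪ C') := by
  classical
  set U : Set α := {x} ∪ ⋃ C ∈ s, C with hU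
  have hUE : U ⊆ M.E := by
    intro z hz
    rcases hz with hz | hz
    · rw [Set.mem_singleton_iff.1 hz]; exact hx.mem_ground
    · obtain ⟨C, hC, hzC⟩ := Set.mem_iUnion₂.1 hz
      exact (hs C hC).1.subset_ground hzC
  have hTfin : T.Finite := M.ground_finite.subset hT.1.subset_ground
  have haf : a ≠ f := fun h => hfU (h ▸ ha.2)
  have hbf : b ≠ f := fun h => hfU (h ▸ hb.2)
  -- `T = {f, a, b}`
  have hTeq : T = {f, a, b} := by
    symm
    apply Set.eq_of_subset_of_ncard_le
    · intro w hw
      simp only [Set.mem_insert_iff, Set.mem_singleton_iff] at hw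
      rcases hw with rfl | rfl | rfl
      · exact hfT
      · exact ha.1
      · exact hb.1
    · rw [hT.2]
      have h3 : ({f, a, b} : Set α).ncard = 3 := by
        rw [Set.ncard_insert_of_notMem, Set.ncard_pair hab]
        simp only [Set.mem_insert_iff, Set.mem_singleton_iff, not_or]
        exact ⟨Ne.symm haf, Ne.symm hbf⟩
      rw [h3]
    · exact hTfin
  have hfcl : f ∈ M.closure ({a, b} : Set α) := by
    have h1 : f ∈ M.closure (T \ {f}) := hT.1.mem_closure_sdiff_singleton_of_mem hfT
    have h2 : T \ {f} ⊆ ({a, b} : Set α) := by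
      intro w hw
      rw [hTeq] at hw
      obtain ⟨hw1, hw2⟩ := hw
      simp only [Set.mem_insert_iff, Set.mem_singleton_iff] at hw1 hw2 ⊢
      rcases hw1 with rfl | rfl | rfl
      · exact absurd rfl hw2
      · exact Or.inl rfl
      · exact Or.inr rfl
    exact M.closure_subset_closure h2 h1
  refine ⟨?_, ?_⟩
  · -- `C ≠ C'`: else `{x, a, b, f}` is a 4-point set of rank 2
    intro hCC'
    subst hCC'
    have hCm := hs C hC
    have hCE : C ⊆ M.E := hCm.1.subset_ground
    have hCfin : C.Finite := M.ground_finite.subset hCE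
    have hax : a ≠ x := fun h => hxT (h ▸ ha.1)
    have hbx : b ≠ x := fun h => hxT (h ▸ hb.1)
    have hCeq : C = {x, a, b} := by
      symm
      apply Set.eq_of_subset_of_ncard_le
      · intro w hw
        simp only [Set.mem_insert_iff, Set.mem_singleton_iff] at hw
        rcases hw with rfl | rfl | rfl
        · exact hCm.2.2
        · exact haC
        · exact hbC'
      · rw [hCm.2.1]
        have h3 : ({x, a, b} : Set α).ncard = 3 := by
          rw [Set.ncard_insert_of_notMem, Set.ncard_pair hab]
          simp only [Set.mem_insert_iff, Set.mem_singleton_iff, not_or]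
          exact ⟨Ne.symm hax, Ne.symm hbx⟩
        rw [h3]
      · exact hCfin
    -- `C ∪ {f} ⊆ cl {a, b}`, rank 2, 4 points
    have hxcl : x ∈ M.closure ({a, b} : Set α) := by
      have h1 : x ∈ M.closure (C \ {x}) := hCm.1.mem_closure_sdiff_singleton_of_mem hCm.2.2
      have h2 : C \ {x} ⊆ ({a, b} : Set α) := by
        intro w hw
        rw [hCeq] at hw
        obtain ⟨hw1, hw2⟩ := hw
        simp only [Set.mem_insert_iff, Set.mem_singleton_iff] at hw1 hw2 ⊢
        rcases hw1 with rfl | rfl | rfl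
        · exact absurd rfl hw2
        · exact Or.inl rfl
        · exact Or.inr rfl
      exact M.closure_subset_closure h2 h1
    have hrab : M.eRk ({a, b} : Set α) = 2 := by
      have hsubT : ({a, b} : Set α) ⊆ T := by
        intro w hw
        simp only [Set.mem_insert_iff, Set.mem_singleton_iff] at hw
        rcases hw with rfl | rfl
        · exact ha.1
        · exact hb.1
      have hne : ({a, b} : Set α) ≠ T := by
        intro h
        have := congrArg Set.ncard h
        rw [Set.ncard_pair hab, hT.2] at this
        omega
      have hind : M.Indep ({a, b} : Set α) := hT.1.ssubset_indep (hsubT.ssubset_of_ne hne)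
      rw [hind.eRk_eq_encard, Set.encard_pair hab]
    have habE : ({a, b} : Set α) ⊆ M.E := by
      intro w hw
      simp only [Set.mem_insert_iff, Set.mem_singleton_iff] at hw
      rcases hw with rfl | rfl
      · exact hUE ha.2
      · exact hUE hb.2
    set Q : Set α := insert f C with hQ
    have hQcl : Q ⊆ M.closure ({a, b} : Set α) := by
      apply Set.insert_subset hfcl
      rw [hCeq]
      intro w hw
      simp only [Set.mem_insert_iff, Set.mem_singleton_iff] at hw
      rcases hw with rfl | rfl | rfl
      · exact hxcl
      · exact M.mem_closure_of_mem (by simp) habE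
      · exact M.mem_closure_of_mem (by simp) habE
    have hrQ : M.eRk Q = 2 := by
      apply le_antisymm
      · calc M.eRk Q ≤ M.eRk (M.closure ({a, b} : Set α)) := M.eRk_mono hQcl
          _ = 2 := by rw [M.eRk_closure_eq, hrab]
      · have : M.eRk C ≤ M.eRk Q := M.eRk_mono (Set.subset_insert f C)
        rw [ThmN.eRk_eq_two_of_mem_trianglesThrough M hCm] at this
        exact this
    have hfC : f ∉ C := fun h => hfU (Set.mem_union_right _ (Set.mem_iUnion₂.2 ⟨C, hC, h⟩))
    have hQE : Q ⊆ M.E := Set.insert_subset hfE hCE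
    have h4 : Q.ncard = 4 := by
      rw [hQ, Set.ncard_insert_of_notMem hfC hCfin, hCm.2.1]
    have := hC1 Q hQE hrQ
    omega
  · -- `f ∈ cl {a, b} ⊆ cl (C ∪ C')`
    refine M.closure_subset_closure ?_ hfcl
    intro w hw
    simp only [Set.mem_insert_iff, Set.mem_singleton_iff] at hw
    rcases hw with rfl | rfl
    · exact Set.mem_union_left _ haC
    · exact Set.mem_union_right _ hbC'

/-- In a free cone, two distinct triangles through `x` span rank exactly `3`. -/
theorem eRk_union_eq_three_of_free (M : Matroid α) [M.Finite]
    (hC1 : ∀ L ⊆ M.E, M.eRk L = 2 → L.ncard ≤ 3) {x : α} (hx : M.IsNonloop x)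
    (s : Finset (Set α)) (hs : ∀ C ∈ s, C ∈ ThmN.trianglesThrough M x)
    (hfree : M.eRk ({x} ∪ ⋃ C ∈ s, C) = ((1 + s.card : ℕ) : ℕ∞))
    {C C' : Set α} (hC : C ∈ s) (hC' : C' ∈ s) (hne : C ≠ C') : M.eRk (C ∪ C') = 3 := by
  classical
  have h := eRk_cone_sub_eq M hC1 hx s hs hfree {C, C'} (by
    intro D hD; simp only [Finset.mem_insert, Finset.mem_singleton] at hD
    rcases hD with rfl | rfl <;> assumption)
  rw [Finset.card_pair hne] at h
  have heq : ({x} ∪ ⋃ D ∈ ({C, C'} : Finset (Set α)), D) = C ∪ C' := by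
    ext w
    simp only [Set.mem_union, Set.mem_singleton_iff, Set.mem_iUnion, Finset.mem_insert,
      Finset.mem_singleton, exists_prop]
    constructor
    · rintro (rfl | ⟨D, (rfl | rfl), hwD⟩)
      · exact Or.inl (hs C hC).2.2
      · exact Or.inl hwD
      · exact Or.inr hwD
    · rintro (hw | hw)
      · exact Or.inr ⟨C, Or.inl rfl, hw⟩
      · exact Or.inr ⟨C', Or.inr rfl, hw⟩
  rw [heq] at h
  rw [h]; norm_num

/-- **THE SAME-PAIR CLAIM.** Two triangles avoiding `x` through the same outside point `f` use the same pair of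
triangles through `x`: if `T` has its cone points on `C ≠ C'` and `T'` has a cone point on `C''`, then
`C'' ∈ {C, C'}`. -/
theorem same_pair_of_triangles_avoiding (M : Matroid α) [M.Finite]
    (hC1 : ∀ L ⊆ M.E, M.eRk L = 2 → L.ncard ≤ 3) {x : α} (hx : M.IsNonloop x)
    (s : Finset (Set α)) (hs : ∀ C ∈ s, C ∈ ThmN.trianglesThrough M x)
    (hfree : M.eRk ({x} ∪ ⋃ C ∈ s, C) = ((1 + s.card : ℕ) : ℕ∞))
    {f : α} (hfU : f ∉ {x} ∪ ⋃ C ∈ s, C) (hfE : f ∈ M.E)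
    {T : Set α} (hT : T ∈ ThmN.triangles M) (hxT : x ∉ T) (hfT : f ∈ T)
    {a b : α} (ha : a ∈ T ∩ ({x} ∪ ⋃ C ∈ s, C)) (hb : b ∈ T ∩ ({x} ∪ ⋃ C ∈ s, C)) (hab : a ≠ b)
    {C C' : Set α} (hC : C ∈ s) (haC : a ∈ C) (hC' : C' ∈ s) (hbC' : b ∈ C')
    {T' : Set α} (hT' : T' ∈ ThmN.triangles M) (hxT' : x ∉ T') (hfT' : f ∈ T')
    (hT'U2 : (T' ∩ ({x} ∪ ⋃ C ∈ s, C)).ncard = 2)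
    {a' : α} (ha' : a' ∈ T' ∩ ({x} ∪ ⋃ C ∈ s, C)) {C'' : Set α} (hC'' : C'' ∈ s) (ha'C'' : a' ∈ C'') :
    C'' = C ∨ C'' = C' := by
  classical
  set U : Set α := {x} ∪ ⋃ C ∈ s, C with hU
  have hUE : U ⊆ M.E := by
    intro z hz
    rcases hz with hz | hz
    · rw [Set.mem_singleton_iff.1 hz]; exact hx.mem_ground
    · obtain ⟨C, hC, hzC⟩ := Set.mem_iUnion₂.1 hz
      exact (hs C hC).1.subset_ground hzC
  by_contra hnot₀
  have hnot : C'' ≠ C ∧ C'' ≠ C' := ⟨fun h => hnot₀ (Or.inl h), fun h => hnot₀ (Or.inr h)⟩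
  obtain ⟨hCC', hfP⟩ := pair_of_triangle_avoiding M hC1 hx s hs hfU hfE hT hxT hfT ha hb hab hC haC hC' hbC'
  -- the second point `b'` of `T'` and its triangle `C'''`
  obtain ⟨a₀, b₀, hab₀, hT'U⟩ := Set.ncard_eq_two.1 hT'U2
  have hb'ex : ∃ b' ∈ T' ∩ U, b' ≠ a' := by
    by_cases h : a' = a₀
    · exact ⟨b₀, by rw [hT'U]; simp, by rw [h]; exact Ne.symm hab₀⟩
    · exact ⟨a₀, by rw [hT'U]; simp, Ne.symm h⟩
  obtain ⟨b', hb', hb'a'⟩ := hb'ex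
  obtain ⟨C''', hC''', hb'C'''⟩ : ∃ D ∈ s, b' ∈ D := by
    rcases hb'.2 with h | h
    · exact absurd (Set.mem_singleton_iff.1 h ▸ hb'.1) hxT'
    · obtain ⟨D, hD, hwD⟩ := Set.mem_iUnion₂.1 h
      exact ⟨D, hD, hwD⟩
  obtain ⟨hCC'', hfP'⟩ :=
    pair_of_triangle_avoiding M hC1 hx s hs hfU hfE hT' hxT' hfT' ha' hb' (Ne.symm hb'a') hC'' ha'C'' hC''' hb'C'''
  -- the two planes `P = cl(C ∪ C')`, `P' = cl(C'' ∪ C''')` both contain `x` and `f`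
  set P := M.closure (C ∪ C') with hP
  set P' := M.closure (C'' ∪ C''') with hP'
  have hCE : ∀ D ∈ s, D ⊆ M.E := fun D hD => (hs D hD).1.subset_ground
  have hrP : M.eRk P = 3 := by rw [hP, M.eRk_closure_eq]; exact eRk_union_eq_three_of_free M hC1 hx s hs hfree hC hC' hCC'
  have hrP' : M.eRk P' = 3 := by rw [hP', M.eRk_closure_eq]; exact eRk_union_eq_three_of_free M hC1 hx s hs hfree hC'' hC''' hCC''
  have hsubmod := M.eRk_inter_add_eRk_union_le P P'
  rw [hrP, hrP'] at hsubmod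
  -- the union contains the cone of the three (or four) triangles
  have hCP : C ⊆ P := (M.subset_closure_of_subset' Set.subset_union_left (hCE C hC))
  have hC'P : C' ⊆ P := (M.subset_closure_of_subset' Set.subset_union_right (hCE C' hC'))
  have hC''P' : C'' ⊆ P' := (M.subset_closure_of_subset' Set.subset_union_left (hCE C'' hC''))
  have hC'''P' : C''' ⊆ P' := (M.subset_closure_of_subset' Set.subset_union_right (hCE C''' hC'''))
  have hxP : x ∈ P := hCP (hs C hC).2.2
  have hxP' : x ∈ P' := hC''P' (hs C'' hC'').2.2
  -- `r(P ∪ P') ≥ 4`: it contains the three distinct triangles `C, C', C''` through `x`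
  have hthree : M.eRk ({x} ∪ ⋃ D ∈ ({C, C', C''} : Finset (Set α)), D) = ((1 + 3 : ℕ) : ℕ∞) := by
    have h := eRk_cone_sub_eq M hC1 hx s hs hfree {C, C', C''} (by
      intro D hD; simp only [Finset.mem_insert, Finset.mem_singleton] at hD
      rcases hD with rfl | rfl | rfl <;> assumption)
    have hc : ({C, C', C''} : Finset (Set α)).card = 3 := by
      rw [Finset.card_insert_of_notMem, Finset.card_pair (Ne.symm hnot.2)]
      simp only [Finset.mem_insert, Finset.mem_singleton, not_or]
      exact ⟨hCC', Ne.symm hnot.1⟩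
    rw [hc] at h
    exact h
  have hsub3 : ({x} ∪ ⋃ D ∈ ({C, C', C''} : Finset (Set α)), D) ⊆ P ∪ P' := by
    intro w hw
    rcases hw with hw | hw
    · rw [Set.mem_singleton_iff.1 hw]; exact Set.mem_union_left _ hxP
    · obtain ⟨D, hD, hwD⟩ := Set.mem_iUnion₂.1 hw
      simp only [Finset.mem_insert, Finset.mem_singleton] at hD
      rcases hD with rfl | rfl | rfl
      · exact Set.mem_union_left _ (hCP hwD)
      · exact Set.mem_union_left _ (hC'P hwD)
      · exact Set.mem_union_right _ (hC''P' hwD)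
  have hrU4 : ((1 + 3 : ℕ) : ℕ∞) ≤ M.eRk (P ∪ P') := by
    rw [← hthree]; exact M.eRk_mono hsub3
  -- so `r(P ∩ P') ≤ 2`; `P ∩ P'` contains `x` and `f`
  have hfP'' : f ∈ P' := hfP'
  have hneI : M.eRk (P ∩ P') ≠ ⊤ :=
    ((M.eRk_le_encard _).trans_lt ((M.ground_finite.subset (M.closure_subset_ground _)).inter_of_left _).encard_lt_top).ne
  obtain ⟨i, hi⟩ := ENat.ne_top_iff_exists.1 hneI
  have hneUn : M.eRk (P ∪ P') ≠ ⊤ :=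
    ((M.eRk_le_encard _).trans_lt ((M.ground_finite.subset (M.closure_subset_ground _)).union
      (M.ground_finite.subset (M.closure_subset_ground _))).encard_lt_top).ne
  obtain ⟨u, hu⟩ := ENat.ne_top_iff_exists.1 hneUn
  rw [← hi, ← hu] at hsubmod
  rw [← hu] at hrU4
  have g1 : i + u ≤ 3 + 3 := by exact_mod_cast hsubmod
  have g2 : 1 + 3 ≤ u := by exact_mod_cast hrU4
  have hi2 : i ≤ 2 := by omega
  -- case split: does `C'''` equal `C` or `C'`?
  by_cases hC'''in : C''' = C ∨ C''' = C'
  · -- `C''' ∪ {f} ⊆ P ∩ P'`: a 4-point set of rank `≤ 2`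
    have hC'''P : C''' ⊆ P := by
      rcases hC'''in with rfl | rfl
      · exact hCP
      · exact hC'P
    set Q : Set α := insert f C''' with hQ
    have hQsub : Q ⊆ P ∩ P' := Set.insert_subset ⟨hfP, hfP''⟩ (Set.subset_inter hC'''P hC'''P')
    have hrQ : M.eRk Q = 2 := by
      apply le_antisymm
      · calc M.eRk Q ≤ M.eRk (P ∩ P') := M.eRk_mono hQsub
          _ = i := by rw [hi]
          _ ≤ 2 := by exact_mod_cast hi2
      · have : M.eRk C''' ≤ M.eRk Q := M.eRk_mono (Set.subset_insert f C''')
        rw [ThmN.eRk_eq_two_of_mem_trianglesThrough M (hs C''' hC''')] at this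
        exact this
    have hfC''' : f ∉ C''' := fun h => hfU (Set.mem_union_right _ (Set.mem_iUnion₂.2 ⟨C''', hC''', h⟩))
    have hC'''fin : C'''.Finite := M.ground_finite.subset (hCE C''' hC''')
    have hQE : Q ⊆ M.E := Set.insert_subset hfE (hCE C''' hC''')
    have h4 : Q.ncard = 4 := by
      rw [hQ, Set.ncard_insert_of_notMem hfC''' hC'''fin, (hs C''' hC''').2.1]
    have := hC1 Q hQE hrQ
    omega
  · -- four distinct triangles: `r(P ∪ P') ≥ 5`, so `r(P ∩ P') ≤ 1` and `{x, f}` has rank `≤ 1`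
    have hC'''in' : C''' ≠ C ∧ C''' ≠ C' :=
      ⟨fun h => hC'''in (Or.inl h), fun h => hC'''in (Or.inr h)⟩
    have hfour : M.eRk ({x} ∪ ⋃ D ∈ ({C, C', C'', C'''} : Finset (Set α)), D) = ((1 + 4 : ℕ) : ℕ∞) := by
      have h := eRk_cone_sub_eq M hC1 hx s hs hfree {C, C', C'', C'''} (by
        intro D hD; simp only [Finset.mem_insert, Finset.mem_singleton] at hD
        rcases hD with rfl | rfl | rfl | rfl <;> assumption)
      have hc : ({C, C', C'', C'''} : Finset (Set α)).card = 4 := by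
        rw [Finset.card_insert_of_notMem, Finset.card_insert_of_notMem, Finset.card_pair hCC'']
        · simp only [Finset.mem_insert, Finset.mem_singleton, not_or]
          exact ⟨Ne.symm hnot.2, Ne.symm hC'''in'.2⟩
        · simp only [Finset.mem_insert, Finset.mem_singleton, not_or]
          exact ⟨hCC', Ne.symm hnot.1, Ne.symm hC'''in'.1⟩
      rw [hc] at h
      exact h
    have hsub4 : ({x} ∪ ⋃ D ∈ ({C, C', C'', C'''} : Finset (Set α)), D) ⊆ P ∪ P' := by
      intro w hw
      rcases hw with hw | hw
      · rw [Set.mem_singleton_iff.1 hw]; exact Set.mem_union_left _ hxP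
      · obtain ⟨D, hD, hwD⟩ := Set.mem_iUnion₂.1 hw
        simp only [Finset.mem_insert, Finset.mem_singleton] at hD
        rcases hD with rfl | rfl | rfl | rfl
        · exact Set.mem_union_left _ (hCP hwD)
        · exact Set.mem_union_left _ (hC'P hwD)
        · exact Set.mem_union_right _ (hC''P' hwD)
        · exact Set.mem_union_right _ (hC'''P' hwD)
    have hrU5 : ((1 + 4 : ℕ) : ℕ∞) ≤ M.eRk (P ∪ P') := by
      rw [← hfour]; exact M.eRk_mono hsub4
    rw [← hu] at hrU5
    have g3 : 1 + 4 ≤ u := by exact_mod_cast hrU5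
    have hi1 : i ≤ 1 := by omega
    -- `{x, f} ⊆ P ∩ P'` has rank `≤ 1`, so `f ∈ cl {x}` and `C ∪ {f}` is a 4-point set of rank `2`
    have hxf : M.eRk ({x, f} : Set α) ≤ 1 := by
      calc M.eRk ({x, f} : Set α) ≤ M.eRk (P ∩ P') :=
            M.eRk_mono (by
              intro w hw
              simp only [Set.mem_insert_iff, Set.mem_singleton_iff] at hw
              rcases hw with rfl | rfl
              · exact ⟨hxP, hxP'⟩
              · exact ⟨hfP, hfP''⟩)
        _ = i := by rw [hi]
        _ ≤ 1 := by exact_mod_cast hi1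
    have hfcl : f ∈ M.closure ({x} : Set α) := by
      have hxr : M.eRk ({x} : Set α) = 1 := hx.eRk_eq
      have hsub : ({x} : Set α) ⊆ ({x, f} : Set α) := by simp
      have := ThmN.subset_closure_of_eRk_le M hsub
        (by intro w hw; simp only [Set.mem_insert_iff, Set.mem_singleton_iff] at hw
            rcases hw with rfl | rfl
            · exact hx.mem_ground
            · exact hfE)
        (Set.toFinite _) (by rw [hxr]; exact hxf)
      exact this (by simp)
    set Q : Set α := insert f C with hQ
    have hQcl : Q ⊆ M.closure C := by
      apply Set.insert_subset
      · exact M.closure_subset_closure (Set.singleton_subset_iff.2 (hs C hC).2.2) hfcl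
      · exact M.subset_closure C (hCE C hC)
    have hrQ : M.eRk Q = 2 := by
      apply le_antisymm
      · calc M.eRk Q ≤ M.eRk (M.closure C) := M.eRk_mono hQcl
          _ = 2 := by rw [M.eRk_closure_eq, ThmN.eRk_eq_two_of_mem_trianglesThrough M (hs C hC)]
      · have : M.eRk C ≤ M.eRk Q := M.eRk_mono (Set.subset_insert f C)
        rw [ThmN.eRk_eq_two_of_mem_trianglesThrough M (hs C hC)] at this
        exact this
    have hfC : f ∉ C := fun h => hfU (Set.mem_union_right _ (Set.mem_iUnion₂.2 ⟨C, hC, h⟩))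
    have hCfin : C.Finite := M.ground_finite.subset (hCE C hC)
    have hQE : Q ⊆ M.E := Set.insert_subset hfE (hCE C hC)
    have h4 : Q.ncard = 4 := by
      rw [hQ, Set.ncard_insert_of_notMem hfC hCfin, (hs C hC).2.1]
    have := hC1 Q hQE hrQ
    omega

end S1

end PercRepro
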